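import Mathlib
import HarnessLib
import Literature.Analysis.FluidPDE.SelfSimilar
import Literature.Analysis.FluidPDE.VectorCalculus
import Literature.Analysis.FluidPDE.SwirlTransportProofs
import Literature.Analysis.FluidPDE.AxisymVorticityAlgebra
import Literature.Analysis.FluidPDE.AxisymmetricVorticityTransport
import Literature.Analysis.FluidPDE.AxisymNoSwirlScalarEq
import Literature.Analysis.FluidPDE.LerayProfileCalculus
import Literature.Analysis.FluidPDE.TsaiMaximumPrinciple
import Literature.Analysis.FluidPDE.TsaiProfileEndgame
import Literature.Analysis.FluidPDE.CurlFreeLiouville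
import Summits.NavierStokesRegularity.NavierStokesRegularity.Theorems.PoloidalWindowDoorPoloidalWindowRigidityRotatedLeray

/-!
# Route `PoloidalWindowDoor`, crux `PoloidalWindowRigidity` (K2, stmt-NavierStokesRegularity-19708) —
# ROTATED Leray profiles II: bounded POLOIDAL solutions are constant (slow rotation `|β| < a`)

Cell ns-regularity-ideate, seat ns-poloidal-K2-p2 (stub-worker; `--supports` the crux, `--as helper`).  Sequel of
`…RotatedLeray` (the identity `ν ΔΠ_β − DΠ_β[U + a y + βJy] = (ν/2)|DU − DUᵀ|² + 2νβ(curl U)₂` for the rotated head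
pressure `Π_β` of a solution of the rotated Leray system `−νΔU + aU + aDU[y] + β(DU[Jy] − JU) + DU[U] + ∇P = 0`,
`div U = 0`).  Here the endgame of Tsai 1998, Theorem 1 (`q = ∞`), is run with the rotation:

* `abs_rotHead_le` — polynomial growth of `Π_β` from `|U| ≤ M` and `|P| ≤ C(1+|y|)^N`;
* `curl_eq_zero_of_spin_eq_zero` — a symmetric Jacobian has no curl;
* **`rotatedLeray_const_of_poloidal`** — `ν > 0`, `a > 0`, `|β| < a`, `U ∈ C³` bounded and POLOIDAL
  (`(curl U)₂ ≡ 0`), `P ∈ C²` of polynomial growth ⇒ `U` is constant: `Π_β` is a polynomially bounded subsolution of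
  the drift–Laplace operator with drift `(U + βJ·) + a y`, `‖U + βJy‖ ≤ M + |β|‖y‖`, so Tsai's Lemma 5.1 (tree
  `isConst_of_driftOp_nonneg_of_poly`, linear rate `|β| < a`) makes `Π_β` constant, whence `|DU − DUᵀ|² ≡ 0`,
  `curl U ≡ 0`, and `curl U = 0`, `div U = 0`, `U` bounded give `U` constant (tree
  `eq_of_curl_eq_zero_of_isDivFree_of_bounded`).  The case `|β| ≥ a` needs Lemma 5.1 with the tangential drift.

WHAT THIS IS NOT: not a claim about Navier–Stokes regularity; not Perelman's problem for general profiles — the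
poloidal, slowly rotating case (bears_on LADDER-NS N0, rung N0-LocalTubeDoorPoloidal).
-/

noncomputable section

-- the summit and its single sub-problem share the name (CONVENTIONS §1), as in every Theorems file
set_option linter.dupNamespace false

namespace Summit.NavierStokesRegularity.NavierStokesRegularity.Theorems.PoloidalWindowDoorPoloidalWindowRigidityRotatedLerayLiouville

open MeasureTheory Set Function Filter Topology TopologicalSpace Metric InnerProductSpace
open scoped RealInnerProductSpace InnerProductSpace Laplacian ContDiff
open Literature.Analysis Literature.Analysis.FluidPDE
open Summit.NavierStokesRegularity.NavierStokesRegularity.Theorems.PoloidalWindowDoorPoloidalWindowRigidityRotatedLeray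

variable {ν a β : ℝ} {U : (EuclideanSpace ℝ (Fin 3)) → (EuclideanSpace ℝ (Fin 3))} {P : (EuclideanSpace ℝ (Fin 3)) → ℝ}

/-! ### the endgame: Tsai's Lemma 5.1 and the curl-free Liouville theorem -/

/-- `‖J y‖ ≤ ‖y‖`. -/
theorem norm_rotGen_le (y : (EuclideanSpace ℝ (Fin 3))) : ‖rotGen y‖ ≤ ‖y‖ := by
  refine le_of_sq_le_sq ?_ (norm_nonneg _)
  rw [norm_rotGen_sq, EuclideanSpace.norm_sq_eq, Fin.sum_univ_three]
  simp only [Real.norm_eq_abs, sq_abs]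
  nlinarith [sq_nonneg (y 2)]

/-- Polynomial growth of the rotated head pressure from a bound on `U` and polynomial growth of `P`. -/
theorem abs_rotHead_le {M C : ℝ} {N : ℕ} (ha : 0 ≤ a) (hM : 0 ≤ M) (hC : 0 ≤ C) (hU : ∀ y, ‖U y‖ ≤ M)
    (hP : ∀ y, |P y| ≤ C * (1 + ‖y‖) ^ N) (y : (EuclideanSpace ℝ (Fin 3))) :
    |(fun z : EuclideanSpace ℝ (Fin 3) => headPressure a U P z + β * ⟪rotGen z, U z⟫) y| ≤ (2⁻¹ * M ^ 2 + C + a * M + |β| * M) * (1 + ‖y‖) ^ (N + 2) := by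
  have hU' : ∀ z, ‖U z‖ ≤ M + 0 * ‖z‖ := fun z => by rw [zero_mul, add_zero]; exact hU z
  have h1 := abs_headPressure_le (N := N) ha le_rfl hM hC hU' hP y
  rw [add_zero] at h1
  set t := 1 + ‖y‖ with ht
  have ht1 : 1 ≤ t := by rw [ht]; linarith [norm_nonneg y]
  have hyt : ‖y‖ ≤ t ^ (N + 2) := by
    calc ‖y‖ ≤ t := by rw [ht]; linarith
      _ = t ^ 1 := (pow_one t).symm
      _ ≤ t ^ (N + 2) := pow_le_pow_right₀ ht1 (by omega)
  have h2 : |β * ⟪rotGen y, U y⟫| ≤ |β| * M * t ^ (N + 2) := by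
    rw [abs_mul]
    calc |β| * |⟪rotGen y, U y⟫| ≤ |β| * (‖rotGen y‖ * ‖U y‖) := by gcongr; exact abs_real_inner_le_norm _ _
      _ ≤ |β| * (‖y‖ * M) := by gcongr; exact norm_rotGen_le y; exact hU y
      _ = |β| * M * ‖y‖ := by ring
      _ ≤ |β| * M * t ^ (N + 2) := by gcongr
  calc |headPressure a U P y + β * ⟪rotGen y, U y⟫|
      ≤ |headPressure a U P y| + |β * ⟪rotGen y, U y⟫| := abs_add_le _ _
    _ ≤ (2⁻¹ * M ^ 2 + C + a * M) * t ^ (N + 2) + |β| * M * t ^ (N + 2) := add_le_add h1 h2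
    _ = (2⁻¹ * M ^ 2 + C + a * M + |β| * M) * t ^ (N + 2) := by ring

/-- A symmetric Jacobian has no curl: `DU(y) = DU(y)ᵀ` (`spin U y = 0`) forces `curl U y = 0`. -/
theorem curl_eq_zero_of_spin_eq_zero (y : (EuclideanSpace ℝ (Fin 3))) (h : spin U y = 0) : curl U y = 0 := by
  haveI : CompleteSpace (EuclideanSpace ℝ (Fin 3)) := FiniteDimensional.complete ℝ (EuclideanSpace ℝ (Fin 3))
  have hadj : ContinuousLinearMap.adjoint (fderiv ℝ U y) = fderiv ℝ U y := by
    have := sub_eq_zero.1 (show fderiv ℝ U y - ContinuousLinearMap.adjoint (fderiv ℝ U y) = 0 from h)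
    exact this.symm
  have hsym : ∀ v w : (EuclideanSpace ℝ (Fin 3)), ⟪fderiv ℝ U y v, w⟫ = ⟪v, fderiv ℝ U y w⟫ := fun v w => by
    rw [← ContinuousLinearMap.adjoint_inner_right, hadj]
  have hD : ∀ i j : Fin 3, fderiv ℝ U y (EuclideanSpace.single j 1) i = fderiv ℝ U y (EuclideanSpace.single i 1) j := by
    intro i j
    have h1 := hsym (EuclideanSpace.single j 1) (EuclideanSpace.single i 1)
    rw [EuclideanSpace.inner_single_right, EuclideanSpace.inner_single_left] at h1
    simpa using h1
  ext k
  fin_cases k <;> simp [curl, hD]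

/-- **POLOIDAL ROTATED LERAY PROFILES WITH BOUNDED VELOCITY ARE CONSTANT (slow rotation `|β| < a`).** Let `(U, P)`
solve the rotated Leray system `−νΔU + aU + a DU[y] + β(DU[Jy] − JU) + DU[U] + ∇P = 0`, `div U = 0` on `(EuclideanSpace ℝ (Fin 3))`
(`ν > 0`, `a > 0`, `U ∈ C³` bounded, `P ∈ C²` of polynomial growth), with `U` POLOIDAL along the rotation axis,
`(curl U)₂ ≡ 0`, and `|β| < a`.  Then `U` is constant.  (Tsai 1998, Theorem 1 (`q = ∞`) is the case `β = 0`; the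
rotation costs nothing on the poloidal class by `driftOp_rotHead`.) -/
theorem rotatedLeray_const_of_poloidal {M C : ℝ} {N : ℕ} (hν : 0 < ν) (ha : 0 < a) (hβ : |β| < a)
    (hU3 : ContDiff ℝ 3 U) (hP2 : ContDiff ℝ 2 P)
    (hpe : ∀ y, -(ν • (Δ U) y) + a • U y + a • fderiv ℝ U y y + β • (fderiv ℝ U y (rotGen y) - rotGen (U y)) +
      convect U U y + gradient P y = 0)
    (hdiv : VectorCalculus.IsDivFree U) (hpol : ∀ y, curl U y 2 = 0)
    (hUbdd : ∀ y, ‖U y‖ ≤ M) (hPpoly : ∀ y, |P y| ≤ C * (1 + ‖y‖) ^ N) (x y : (EuclideanSpace ℝ (Fin 3))) : U x = U y := by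
  have hU2 : ContDiff ℝ 2 U := hU3.of_le (by norm_num)
  have hM : 0 ≤ M := (norm_nonneg _).trans (hUbdd 0)
  have hC : 0 ≤ C := by
    have h := (abs_nonneg _).trans (hPpoly 0)
    rw [norm_zero, add_zero, one_pow, mul_one] at h
    exact h
  -- the rotated head pressure is a `C²`, polynomially bounded subsolution
  set Θ : (EuclideanSpace ℝ (Fin 3)) → ℝ := (fun z : EuclideanSpace ℝ (Fin 3) => headPressure a U P z + β * ⟪rotGen z, U z⟫) with hΘ
  have hΘ2 : ContDiff ℝ 2 Θ := contDiff_rotHead hU2 hP2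
  have hsub : ∀ z, 0 ≤ driftOp ν a (fun z => U z + β • rotGen z) Θ z :=
    driftOp_rotHead_nonneg_of_poloidal hν.le hU3 hP2 hpe hdiv hpol
  have hgrowth : ∀ z, |Θ z| ≤ (2⁻¹ * M ^ 2 + C + a * M + |β| * M) * (1 + ‖z‖) ^ (N + 2) :=
    abs_rotHead_le ha.le hM hC hUbdd hPpoly
  -- the drift `U + βJy` has linear rate `|β| < b < a` at infinity
  set b : ℝ := (|β| + a) / 2 with hb
  have hb0 : 0 ≤ b := by rw [hb]; positivity
  have hba : b < a := by rw [hb]; linarith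
  have hbβ : |β| < b := by rw [hb]; linarith
  have hUc : Continuous fun z => U z + β • rotGen z :=
    hU2.continuous.add ((contDiff_rotGen (n := 0)).continuous.const_smul β)
  set r₀ : ℝ := M / (b - |β|) with hr₀
  have hU' : ∀ z, r₀ ≤ ‖z‖ → ‖U z + β • rotGen z‖ ≤ b * ‖z‖ := by
    intro z hz
    have hgap : 0 < b - |β| := sub_pos.2 hbβ
    have hMz : M ≤ (b - |β|) * ‖z‖ := by
      rw [hr₀, div_le_iff₀ hgap] at hz
      linarith [hz]
    calc ‖U z + β • rotGen z‖ ≤ ‖U z‖ + ‖β • rotGen z‖ := norm_add_le _ _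
      _ ≤ M + |β| * ‖z‖ := by
          rw [norm_smul, Real.norm_eq_abs]
          exact add_le_add (hUbdd z) (mul_le_mul_of_nonneg_left (norm_rotGen_le z) (abs_nonneg β))
      _ ≤ b * ‖z‖ := by linarith
  -- Tsai's Lemma 5.1: `Θ` is constant
  have hconst : ∀ z w, Θ z = Θ w := fun z w =>
    isConst_of_driftOp_nonneg_of_poly hν hb0 hba hΘ2 hUc hsub hU' hgrowth z w
  -- hence the drift–Laplace expression vanishes and `DU` is symmetric everywhere
  have hΘfun : Θ = fun _ => Θ 0 := funext fun z => hconst z 0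
  have hzero : ∀ z, driftOp ν a (fun z => U z + β • rotGen z) Θ z = 0 := by
    intro z
    rw [driftOp, hΘfun, laplacian_const_eq_zero, fderiv_fun_const]
    simp
  have hcurl : ∀ z, curl U z = 0 := by
    intro z
    have h1 := driftOp_rotHead_of_poloidal hU3 hP2 hpe hdiv hpol z
    rw [← hΘ, hzero z] at h1
    have h2 : frobeniusNormSq (spin U z) = 0 := by
      have : ν / 2 ≠ 0 := by positivity
      have h3 : ν / 2 * frobeniusNormSq (spin U z) = 0 := h1.symm
      exact (mul_eq_zero.1 h3).resolve_left this
    exact curl_eq_zero_of_spin_eq_zero z (eq_zero_of_frobeniusNormSq_eq_zero h2)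
  exact eq_of_curl_eq_zero_of_isDivFree_of_bounded hU2 hcurl hdiv hUbdd x y


end Summit.NavierStokesRegularity.NavierStokesRegularity.Theorems.PoloidalWindowDoorPoloidalWindowRigidityRotatedLerayLiouville

end
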